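import Mathlib.GroupTheory.Commensurable
import Mathlib.GroupTheory.Complement
import Mathlib.GroupTheory.CosetCover
import Mathlib.Algebra.Group.Subgroup.Pointwise
import Mathlib.Topology.Algebra.Group.Basic
import Mathlib.Topology.Algebra.OpenSubgroup
import HarnessLib

/-!
# [IUTchI] §2: commensurators — the group-theoretic steps of the proofs of Prop. 2.2 – Cor. 2.5

Mochizuki, *Inter-universal Teichmüller theory I: construction of Hodge theaters*, kurims
manuscript (May 2020), §2, pp. 45–51 [cite: Mochizuki2012, §2 pp.45-51] (D-0012 claim key;
series status DISPUTED — but everything in this file is plain (topological) group theory, PROVED).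
This is the Mathlib-only toolkit of the proof companions of
`Literature.IUT.HodgeTheaters.TemperedCoverings` (abc-iut-L5-t1; "`H` commensurably terminal" =
`Subgroup.Commensurable.commensurator H = H`, "normally terminal" = `Subgroup.normalizer H = H`, as
there); each lemma is the abstract form of a step the printed proofs take in one sentence:
* `IsCommensurablyTerminal.comap_of_surjective` — commensurable terminality pulls back along a
  surjection ("Assertion (i) follows immediately from Proposition 2.2", proof of Cor. 2.3, p. 48);
* `IsCommensurablyTerminal.of_map_injective` — and descends along an injection ("[hence, also in
  `Π^tp_𝔾`]", Prop. 2.2, p. 45);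
* `IsCommensurablyTerminal.of_subgroupOf` — `C_P(K) ⊆ L` and `C_L(K) = K` give `C_P(K) = K`
  ("`C_{Π̂_𝔾}(Π^tp_ℍ) ⊆ C_{Π̂_ℍ}(Π^tp_ℍ) = Π^tp_ℍ`", proof of Prop. 2.2, p. 46);
* `isCommensurablyTerminal_of_inf_ker` — an extension `Q ↠ G` by a commensurably terminal
  `Q ∩ Ker`, inside `P → G`, is commensurably terminal ("in light of the exact sequences of
  assertion (iii), assertion (iv) follows immediately from assertion (i)", p. 49; last sentence
  of the proof of Prop. 2.4 (iii), p. 51);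
* `normalizer_inf_eq_of_isNormallyTerminal` — `N_P(M) ∩ Δ = M` for `M` normally terminal in `Δ`
  (exactness at `Δ_{X,ℍ}` in Cor. 2.3 (iii), p. 47);
* `relIndex_topologicalClosure_ne_zero`, `conjAct_smul_topologicalClosure`,
  `commensurator_le_topologicalClosure` — commensurating `K` commensurates `cl K`
  ("`C_{Π̂_𝔾}(Π^tp_ℍ) ⊆ C_{Π̂_𝔾}(Π̂_ℍ)` [thinking of `Π̂_ℍ` as the pro-`Σ̂` completion of `Π^tp_ℍ`]", p. 46).
No definitions; nothing about semi-graphs of anabelioids or tempered fundamental groups is used or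
proved here.
-/

namespace Literature.IUT.HodgeTheaters

open Pointwise Topology

/-! ### Commensurators -/

section Commensurators

variable {A : Type*} [Group A] {B : Type*} [Group B]

/-- A subgroup lies in its own commensurator. [cite: Mochizuki2012, §2 p.45] -/
theorem le_commensurator (H : Subgroup A) : H ≤ Subgroup.Commensurable.commensurator H := by
  intro h hh
  rw [Subgroup.Commensurable.commensurator_mem_iff,
    Subgroup.conjAct_pointwise_smul_eq_self (Subgroup.le_normalizer hh)]

/-- `H` is commensurably terminal as soon as its commensurator is contained in it.
[cite: Mochizuki2012, §2 p.45] -/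
theorem isCommensurablyTerminal_of_le {H : Subgroup A}
    (h : Subgroup.Commensurable.commensurator H ≤ H) :
    Subgroup.Commensurable.commensurator H = H :=
  le_antisymm h (le_commensurator H)

/-- The image of a conjugate `a T a⁻¹` under a homomorphism `f` is the conjugate `f(a) f(T) f(a)⁻¹`
(`ConjAct` form). [cite: Mochizuki2012, §2 p.45] -/
theorem map_conjAct_smul (f : A →* B) (a : A) (T : Subgroup A) :
    (ConjAct.toConjAct a • T).map f = ConjAct.toConjAct (f a) • T.map f := by
  ext y
  simp only [Subgroup.mem_map, Subgroup.mem_smul_pointwise_iff_exists, ConjAct.toConjAct_smul]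
  constructor
  · rintro ⟨x, ⟨t, ht, rfl⟩, rfl⟩
    exact ⟨f t, ⟨t, ht, rfl⟩, by simp only [map_mul, map_inv]⟩
  · rintro ⟨s, ⟨t, ht, rfl⟩, rfl⟩
    exact ⟨a * t * a⁻¹, ⟨t, ht, rfl⟩, by simp only [map_mul, map_inv]⟩

/-- The image of a conjugate `a T a⁻¹` under a homomorphism `f` is the conjugate `f(a) f(T) f(a)⁻¹`
(`MulAut.conj` form). [cite: Mochizuki2012, §2 p.51] -/
theorem map_conj_smul (f : A →* B) (a : A) (T : Subgroup A) :
    (MulAut.conj a • T).map f = MulAut.conj (f a) • T.map f := by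
  ext y
  simp only [Subgroup.mem_map, Subgroup.mem_smul_pointwise_iff_exists, MulAut.smul_def,
    MulAut.conj_apply]
  constructor
  · rintro ⟨x, ⟨t, ht, rfl⟩, rfl⟩
    exact ⟨f t, ⟨t, ht, rfl⟩, by simp only [map_mul, map_inv]⟩
  · rintro ⟨s, ⟨t, ht, rfl⟩, rfl⟩
    exact ⟨a * t * a⁻¹, ⟨t, ht, rfl⟩, by simp only [map_mul, map_inv]⟩

/-- **Commensurable terminality pulls back along surjections**: if `f : A ↠ B` is surjective and
`S ⊆ B` is commensurably terminal, so is `f⁻¹(S) ⊆ A`.  [This is the step "Assertion (i) follows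
immediately from Proposition 2.2" of the proof of Cor. 2.3, p. 48, for the surjections
`Δ^tp_X ↠ Π^tp_𝔾`, `Δ̂_X ↠ Π̂_𝔾`.] [cite: Mochizuki2012, Cor 2.3(i) p.48] -/
theorem IsCommensurablyTerminal.comap_of_surjective (f : A →* B) (hf : Function.Surjective f)
    {S : Subgroup B} (hS : Subgroup.Commensurable.commensurator S = S) :
    Subgroup.Commensurable.commensurator (S.comap f) = S.comap f := by
  refine isCommensurablyTerminal_of_le fun a ha => ?_
  rw [Subgroup.Commensurable.commensurator_mem_iff] at ha
  have hker : f.ker ≤ S.comap f := by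
    rw [← MonoidHom.comap_bot]; exact Subgroup.comap_mono bot_le
  have hker' : f.ker ≤ ConjAct.toConjAct a • S.comap f := by
    rw [← (inferInstance : f.ker.Normal).conjAct (ConjAct.toConjAct a)]
    exact Subgroup.pointwise_smul_le_pointwise_smul_iff.mpr hker
  have key : (ConjAct.toConjAct a • S.comap f).map f = ConjAct.toConjAct (f a) • S := by
    rw [map_conjAct_smul, Subgroup.map_comap_eq_self_of_surjective hf]
  have hmm := Subgroup.relIndex_map_map f (ConjAct.toConjAct a • S.comap f) (S.comap f)
  have hmm' := Subgroup.relIndex_map_map f (S.comap f) (ConjAct.toConjAct a • S.comap f)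
  rw [key, Subgroup.map_comap_eq_self_of_surjective hf, sup_eq_left.mpr hker',
    sup_eq_left.mpr hker] at hmm hmm'
  have hfa : f a ∈ Subgroup.Commensurable.commensurator S := by
    rw [Subgroup.Commensurable.commensurator_mem_iff]
    exact ⟨hmm ▸ ha.1, hmm' ▸ ha.2⟩
  rw [hS] at hfa
  exact hfa

/-- **Commensurable terminality descends along injections**: if `f : A ↪ B` is injective and
`f(T) ⊆ B` is commensurably terminal, so is `T ⊆ A` [the "[hence, also in `Π^tp_𝔾`]" of Prop. 2.2,
p. 45, for `Π^tp_ℍ ⊆ Π^tp_𝔾 ↪ Π̂_𝔾`]. [cite: Mochizuki2012, Prop 2.2 p.45] -/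
theorem IsCommensurablyTerminal.of_map_injective (f : A →* B) (hf : Function.Injective f)
    {T : Subgroup A} (h : Subgroup.Commensurable.commensurator (T.map f) = T.map f) :
    Subgroup.Commensurable.commensurator T = T := by
  refine isCommensurablyTerminal_of_le fun a ha => ?_
  rw [Subgroup.Commensurable.commensurator_mem_iff] at ha
  have hfa : f a ∈ Subgroup.Commensurable.commensurator (T.map f) := by
    rw [Subgroup.Commensurable.commensurator_mem_iff, ← map_conjAct_smul]
    exact ⟨by rw [Subgroup.relIndex_map_map_of_injective _ _ hf]; exact ha.1,
      by rw [Subgroup.relIndex_map_map_of_injective _ _ hf]; exact ha.2⟩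
  rw [h, Subgroup.mem_map_iff_mem hf] at hfa
  exact hfa

/-- **Commensurable terminality inside a bigger subgroup**: if `K ≤ L`, the commensurator of `K`
lies in `L`, and `K` is commensurably terminal in `L`, then `K` is commensurably terminal [the step
"`Π^tp_ℍ ⊆ C_{Π̂_𝔾}(Π^tp_ℍ) ⊆ C_{Π̂_ℍ}(Π^tp_ℍ) = Π^tp_ℍ`" of the proof of Prop. 2.2, p. 46].
[cite: Mochizuki2012, Prop 2.2 p.46] -/
theorem IsCommensurablyTerminal.of_subgroupOf {K L : Subgroup A} (hKL : K ≤ L)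
    (hL : Subgroup.Commensurable.commensurator K ≤ L)
    (h : Subgroup.Commensurable.commensurator (K.subgroupOf L) = K.subgroupOf L) :
    Subgroup.Commensurable.commensurator K = K := by
  refine isCommensurablyTerminal_of_le fun γ hγ => ?_
  have hγL : γ ∈ L := hL hγ
  rw [Subgroup.Commensurable.commensurator_mem_iff] at hγ
  have hmap : (K.subgroupOf L).map L.subtype = K := by
    rw [Subgroup.subgroupOf_map_subtype, inf_eq_left.mpr hKL]
  have key : (⟨γ, hγL⟩ : L) ∈ Subgroup.Commensurable.commensurator (K.subgroupOf L) := by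
    rw [Subgroup.Commensurable.commensurator_mem_iff]
    constructor
    · rw [← Subgroup.relIndex_map_map_of_injective _ _ L.subtype_injective, map_conjAct_smul, hmap]
      exact hγ.1
    · rw [← Subgroup.relIndex_map_map_of_injective _ _ L.subtype_injective, map_conjAct_smul, hmap]
      exact hγ.2
  rw [h, Subgroup.mem_subgroupOf] at key
  exact key

/-- **Extensions of commensurably terminal subgroups**: let `pr : P → G`, `Q ⊆ P` a subgroup with
`Q ↠ G` and `Q ∩ Ker(pr) = M`, where `M ⊆ Ker(pr)` is commensurably terminal; then `Q` is
commensurably terminal in `P`.  [This is the step "in light of the exact sequences of assertion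
(iii), assertion (iv) follows immediately from assertion (i)" of the proof of Cor. 2.3, p. 49, and
the last sentence of the proof of Prop. 2.4 (iii), p. 51.] [cite: Mochizuki2012, Cor 2.3(iv) p.49] -/
theorem isCommensurablyTerminal_of_inf_ker {P : Type*} [Group P] {G : Type*} [Group G]
    (pr : P →* G) (Q : Subgroup P) (M : Subgroup pr.ker) (hM : Subgroup.Commensurable.commensurator M = M)
    (hinf : Q ⊓ pr.ker = M.map pr.ker.subtype)
    (hsurj : Function.Surjective (pr.comp Q.subtype)) :
    Subgroup.Commensurable.commensurator Q = Q := by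
  refine isCommensurablyTerminal_of_le fun γ hγ => ?_
  obtain ⟨⟨q, hq⟩, hq'⟩ := hsurj (pr γ)
  simp only [MonoidHom.coe_comp, Subgroup.coe_subtype, Function.comp_apply] at hq'
  -- `δ := q⁻¹ γ ∈ Ker(pr)` still commensurates `Q`
  have hδker : q⁻¹ * γ ∈ pr.ker := by
    rw [MonoidHom.mem_ker, map_mul, map_inv, hq', inv_mul_cancel]
  have hδcomm : q⁻¹ * γ ∈ Subgroup.Commensurable.commensurator Q :=
    mul_mem (inv_mem (le_commensurator Q hq)) hγ
  suffices hδQ : q⁻¹ * γ ∈ Q by simpa only [mul_inv_cancel_left] using mul_mem hq hδQ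
  rw [Subgroup.Commensurable.commensurator_mem_iff] at hδcomm
  -- transfer the commensurability of `δ Q δ⁻¹`, `Q` to `δ M δ⁻¹`, `M` inside `Ker(pr)`
  have hkerfix : ConjAct.toConjAct (q⁻¹ * γ) • pr.ker = pr.ker :=
    (inferInstance : pr.ker.Normal).conjAct _
  have e : (ConjAct.toConjAct (⟨q⁻¹ * γ, hδker⟩ : pr.ker) • M).map pr.ker.subtype =
      ConjAct.toConjAct (q⁻¹ * γ) • Q ⊓ pr.ker := by
    rw [map_conjAct_smul, ← hinf, Subgroup.smul_inf]
    change ConjAct.toConjAct (q⁻¹ * γ) • Q ⊓ ConjAct.toConjAct (q⁻¹ * γ) • pr.ker = _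
    rw [hkerfix]
  have hM' : (⟨q⁻¹ * γ, hδker⟩ : pr.ker) ∈ Subgroup.Commensurable.commensurator M := by
    rw [Subgroup.Commensurable.commensurator_mem_iff]
    constructor
    · rw [← Subgroup.relIndex_map_map_of_injective _ M pr.ker.subtype_injective, e, ← hinf]
      -- `(δQδ⁻¹ ∩ K).relIndex (Q ∩ K) = (δQδ⁻¹).relIndex (Q ∩ K) ≠ 0`
      have h1 : (ConjAct.toConjAct (q⁻¹ * γ) • Q ⊓ pr.ker).relIndex (Q ⊓ pr.ker) =
          (ConjAct.toConjAct (q⁻¹ * γ) • Q).relIndex (Q ⊓ pr.ker) := by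
        rw [← Subgroup.inf_relIndex_right (ConjAct.toConjAct (q⁻¹ * γ) • Q ⊓ pr.ker),
          inf_assoc, inf_left_comm pr.ker, inf_idem, Subgroup.inf_relIndex_right]
      rw [h1]
      exact fun h0 => hδcomm.1 (Subgroup.relIndex_eq_zero_of_le_right inf_le_left h0)
    · rw [← Subgroup.relIndex_map_map_of_injective M _ pr.ker.subtype_injective, e, ← hinf]
      have h2 : (Q ⊓ pr.ker).relIndex (ConjAct.toConjAct (q⁻¹ * γ) • Q ⊓ pr.ker) =
          Q.relIndex (ConjAct.toConjAct (q⁻¹ * γ) • Q ⊓ pr.ker) := by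
        rw [← Subgroup.inf_relIndex_right (Q ⊓ pr.ker), inf_assoc,
          inf_left_comm pr.ker, inf_idem, Subgroup.inf_relIndex_right]
      rw [h2]
      exact fun h0 => hδcomm.2 (Subgroup.relIndex_eq_zero_of_le_right inf_le_left h0)
  rw [hM] at hM'
  have hmem : q⁻¹ * γ ∈ M.map pr.ker.subtype := ⟨⟨q⁻¹ * γ, hδker⟩, hM', rfl⟩
  rw [← hinf] at hmem
  exact hmem.1

/-- For a normally terminal `M ⊆ Δ ⊆ P`: `N_P(M) ∩ Δ = M` [the exactness at `Δ_{X,ℍ}` of the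
sequences of Cor. 2.3 (iii), p. 47, with `Π_{X,ℍ} := N_{Π_X}(Δ_{X,ℍ})`]. [cite: Mochizuki2012, Cor 2.3(iii) p.47] -/
theorem normalizer_inf_eq_of_isNormallyTerminal {P : Type*} [Group P] (Δ : Subgroup P)
    (M : Subgroup Δ) (hM : Subgroup.normalizer (M : Set Δ) = M) :
    Subgroup.normalizer ((M.map Δ.subtype : Subgroup P) : Set P) ⊓ Δ = M.map Δ.subtype := by
  have hle : M.map Δ.subtype ≤ Δ := Subgroup.map_subtype_le M
  refine le_antisymm (fun x hx => ?_) (le_inf Subgroup.le_normalizer hle)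
  have hx' : (⟨x, hx.2⟩ : Δ) ∈ (Subgroup.normalizer ((M.map Δ.subtype : Subgroup P) : Set P)).subgroupOf Δ :=
    hx.1
  rw [Subgroup.subgroupOf_normalizer_eq hle] at hx'
  have hMM : (M.map Δ.subtype).subgroupOf Δ = M :=
    Subgroup.comap_map_eq_self_of_injective Δ.subtype_injective (H := M)
  rw [hMM] at hx'
  rw [hM] at hx'
  exact ⟨⟨x, hx.2⟩, hx', rfl⟩

end Commensurators

/-! ### Closures and commensurators in topological groups -/

section Closure

variable {P : Type*} [Group P] [TopologicalSpace P] [IsTopologicalGroup P]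

/-- If `M ≤ K` has finite index in `K`, then the closure of `M` has finite index in the closure of
`K`: `K` is a finite union of cosets `kᵢ M`, so `cl K` lies in the finite union of the closed sets
`kᵢ cl M`. [cite: Mochizuki2012, Prop 2.2 p.46] -/
theorem relIndex_topologicalClosure_ne_zero {M K : Subgroup P} (hMK : M ≤ K)
    (h : M.relIndex K ≠ 0) : M.topologicalClosure.relIndex K.topologicalClosure ≠ 0 := by
  haveI : (M.subgroupOf K).FiniteIndex := ⟨h⟩
  obtain ⟨S, hS, -⟩ := (M.subgroupOf K).exists_isComplement_left 1
  have hSfin : S.Finite := hS.finite_left_iff.mpr inferInstance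
  -- `K ⊆ ⋃_{s ∈ S} s • M`
  have hcov : ∀ x ∈ K, ∃ s ∈ S, x ∈ ((s : K) : P) • (M : Set P) := by
    intro x hx
    have hx' : (⟨x, hx⟩ : K) ∈ S * ((M.subgroupOf K : Subgroup K) : Set K) := by
      rw [hS.mul_eq]; trivial
    obtain ⟨s, hs, m, hm, hsm⟩ := Set.mem_mul.mp hx'
    refine ⟨s, hs, (m : P), hm, ?_⟩
    simpa only [smul_eq_mul, Subgroup.coe_mul] using congrArg Subtype.val hsm
  -- `cl K ⊆ ⋃_{s ∈ S} s • cl M`, a finite union of closed sets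
  have hcov' : ∀ x ∈ K.topologicalClosure, ∃ s ∈ S,
      x ∈ ((s : K) : P) • (M.topologicalClosure : Set P) := by
    intro x hx
    have hsub : (K : Set P) ⊆
        ⋃ s ∈ hSfin.toFinset, ((s : K) : P) • (M.topologicalClosure : Set P) := by
      intro y hy
      obtain ⟨s, hs, hy'⟩ := hcov y hy
      exact Set.mem_iUnion₂.mpr
        ⟨s, hSfin.mem_toFinset.mpr hs, Set.smul_set_mono M.le_topologicalClosure hy'⟩
    have hclosed : IsClosed
        (⋃ s ∈ hSfin.toFinset, ((s : K) : P) • (M.topologicalClosure : Set P)) :=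
      isClosed_biUnion_finset fun s _ => M.isClosed_topologicalClosure.smul _
    have hx' := (closure_minimal hsub hclosed) (by rwa [← Subgroup.topologicalClosure_coe])
    obtain ⟨s, hs, hx''⟩ := Set.mem_iUnion₂.mp hx'
    exact ⟨s, hSfin.mem_toFinset.mp hs, hx''⟩
  -- hence `cl K` is covered by finitely many cosets of `cl M ∩ cl K`
  have hKL : K ≤ K.topologicalClosure := K.le_topologicalClosure
  have hML : M.topologicalClosure ≤ K.topologicalClosure := Subgroup.topologicalClosure_mono hMK
  let g : K → K.topologicalClosure := fun i => ⟨i, hKL i.2⟩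
  have hunion : ⋃ i ∈ hSfin.toFinset, g i •
      ((M.topologicalClosure.subgroupOf K.topologicalClosure :
        Subgroup K.topologicalClosure) : Set K.topologicalClosure) = Set.univ := by
    refine Set.eq_univ_of_forall fun x => ?_
    obtain ⟨s, hs, m, hm, hmx⟩ := hcov' x x.2
    exact Set.mem_iUnion₂.mpr ⟨s, hSfin.mem_toFinset.mpr hs, ⟨m, hML hm⟩, hm, Subtype.ext hmx⟩
  exact (Subgroup.finiteIndex_of_leftCoset_cover_const hunion).index_ne_zero

/-- Conjugation commutes with closure: `γ (cl K) γ⁻¹ = cl (γ K γ⁻¹)`. [cite: Mochizuki2012, Prop 2.2 p.46] -/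
theorem conjAct_smul_topologicalClosure (γ : P) (K : Subgroup P) :
    ConjAct.toConjAct γ • K.topologicalClosure = (ConjAct.toConjAct γ • K).topologicalClosure := by
  apply le_antisymm
  · rw [Subgroup.pointwise_smul_subset_iff]
    apply Subgroup.topologicalClosure_minimal
    · rw [← Subgroup.pointwise_smul_subset_iff]
      exact Subgroup.le_topologicalClosure _
    · have e : (((ConjAct.toConjAct γ)⁻¹ • (ConjAct.toConjAct γ • K).topologicalClosure :
          Subgroup P) : Set P) =
          (fun x => γ * x * γ⁻¹) ⁻¹' ((ConjAct.toConjAct γ • K).topologicalClosure : Set P) := by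
        ext x
        simp only [SetLike.mem_coe, Subgroup.mem_inv_pointwise_smul_iff, ConjAct.toConjAct_smul,
          Set.mem_preimage]
      rw [e]
      exact (Subgroup.isClosed_topologicalClosure _).preimage
        (IsTopologicalGroup.continuous_conj γ)
  · apply Subgroup.topologicalClosure_minimal
    · exact Subgroup.pointwise_smul_le_pointwise_smul_iff.mpr K.le_topologicalClosure
    · have e : ((ConjAct.toConjAct γ • K.topologicalClosure : Subgroup P) : Set P) =
          (fun x => γ⁻¹ * x * γ⁻¹⁻¹) ⁻¹' (K.topologicalClosure : Set P) := by
        ext x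
        simp only [SetLike.mem_coe, Subgroup.mem_pointwise_smul_iff_inv_smul_mem,
          ← ConjAct.toConjAct_inv, ConjAct.toConjAct_smul, Set.mem_preimage]
      rw [e]
      exact K.isClosed_topologicalClosure.preimage (IsTopologicalGroup.continuous_conj γ⁻¹)

/-- **Commensurating a subgroup commensurates its closure**: `C_P(K) ⊆ C_P(cl K)` [the inclusion
"`C_{Π̂_𝔾}(Π^tp_ℍ) ⊆ C_{Π̂_𝔾}(Π̂_ℍ)` [where we think of `Π̂_ℍ` … as the pro-`Σ̂` completion of `Π^tp_ℍ`]" of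
the proof of Prop. 2.2, p. 46]. [cite: Mochizuki2012, Prop 2.2 p.46] -/
theorem commensurator_le_topologicalClosure (K : Subgroup P) :
    Subgroup.Commensurable.commensurator K ≤
      Subgroup.Commensurable.commensurator K.topologicalClosure := by
  intro γ hγ
  rw [Subgroup.Commensurable.commensurator_mem_iff] at hγ ⊢
  rw [conjAct_smul_topologicalClosure]
  have h1 : (ConjAct.toConjAct γ • K ⊓ K).relIndex K ≠ 0 := by
    rw [Subgroup.inf_relIndex_right]; exact hγ.1
  have h2 : (ConjAct.toConjAct γ • K ⊓ K).relIndex (ConjAct.toConjAct γ • K) ≠ 0 := by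
    rw [Subgroup.inf_relIndex_left]; exact hγ.2
  have h1' := relIndex_topologicalClosure_ne_zero inf_le_right h1
  have h2' := relIndex_topologicalClosure_ne_zero inf_le_left h2
  exact ⟨fun h0 => h1' (Subgroup.relIndex_eq_zero_of_le_left
      (Subgroup.topologicalClosure_mono inf_le_left) h0),
    fun h0 => h2' (Subgroup.relIndex_eq_zero_of_le_left
      (Subgroup.topologicalClosure_mono inf_le_right) h0)⟩

end Closure

end Literature.IUT.HodgeTheaters
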